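import Mathlib
import HarnessLib
import HarnessLib.Audit

/-!
# The core vertex bound — sharpest statement of the generic-`g` line towards KPTT rung 1

Koiran–Portier–Tavenas–Thomassé (arXiv:1308.2286, §5, problem 1) ask whether the Newton polygon of
`f g + 1`, for `t`-sparse bivariate `f, g`, has `O(t)` vertices (known: `O(t^{4/3})`).  For `g` with
generic coefficients (any support `Q`) and arbitrary `f`, the south-west part of that question reduces
(this seat's notes, `paper/R1struct.md` §8) to a statement about the planar affine semigroup
`S₀ = ℕ Q ⊂ ℤ²`: if `H` is a `C`-convex lattice polygon (`C = cone Q`) whose vertex set `V` lies in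
`S₀` and which swallows all but finitely many points of `S₀`, then the number of vertices of `H` that
are not generators is at most the number of semigroup points outside `H`.

This file records that statement precisely, as the conjecture `CoreVertexBound` (a `Prop`, not
asserted), in an elementary lattice encoding (vertices and non-membership are witnessed by integer
linear functionals — exact by Farkas duality for the polyhedron `conv V + cone Q`), and proves that
the bound is attained (`coreVertexBound_tight`): with `Q = {(1,1),(4,3),(5,6)}` the five composite
points `(8,6),(5,4),(3,3),(6,7),(10,12)` are the vertices of a `C`-convex polygon leaving exactly the
five semigroup points `0,(1,1),(2,2),(4,3),(5,6)` outside.  Evidence for the conjecture: no violation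
in ≈ 6·10⁵ exact instances (random, adversarially hill-climbed, and exhaustive over small boxes),
several tight families; the case of two boundary rays with all deleted points on the rays is
`card_swVertices_le_card_add_one` (`SoloBlindTwoRays`).

References: Koiran–Portier–Tavenas–Thomassé 2015 (arXiv:1308.2286) §5.
-/

namespace Summit.ValiantsHypothesis.ValiantsHypothesis.Theorems

/-- **Core vertex bound** (conjecture; the sharpest open statement of this line).
For finite `Q V D ⊆ ℤ²`: if every `v ∈ V` lies in the submonoid `S₀` generated by `Q` and is a
vertex of `H = conv V + cone Q` (witnessed by an integer functional `λ = (a,b)` that is positive on `Q`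
and strictly minimised over `V` at `v`), and `D` contains every point `y ∈ S₀` outside `H` (witnessed
by an integer functional nonnegative on `Q` with `λ y < λ w` for all `w ∈ V`), then the number of
vertices that are not generators is at most `|D|`.  Equivalently (`D = S₀ ∖ H`, which contains `0`):
`#(V ∖ Q) ≤ #(S₀ ∖ H)`.  For `g` generic this gives `O(t)` vertices on the south-west chain of
`Newt(fg+1)` (KPTT §5, problem 1).  CONJECTURAL — stated as a `Prop`, not asserted; tight by
`coreVertexBound_tight`. -/
@[conjecture] def CoreVertexBound : Prop :=
  ∀ (Q V D : Finset (ℤ × ℤ)),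
    (∀ v ∈ V, v ∈ AddSubmonoid.closure (↑Q : Set (ℤ × ℤ))) →
    (∀ v ∈ V, ∃ a b : ℤ, (∀ q ∈ Q, 0 < a * q.1 + b * q.2) ∧
        ∀ w ∈ V, w ≠ v → a * v.1 + b * v.2 < a * w.1 + b * w.2) →
    (∀ y ∈ AddSubmonoid.closure (↑Q : Set (ℤ × ℤ)),
        (∃ a b : ℤ, (∀ q ∈ Q, 0 ≤ a * q.1 + b * q.2) ∧
          ∀ w ∈ V, a * y.1 + b * y.2 < a * w.1 + b * w.2) → y ∈ D) →
    (V \ Q).card ≤ D.card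

/-- A linear functional that is nonnegative on the generators is nonnegative on every element of the
generated additive submonoid of `ℤ²`. -/
theorem linForm_nonneg_of_mem_closure {Q : Finset (ℤ × ℤ)} {a b : ℤ}
    (hq : ∀ q ∈ Q, 0 ≤ a * q.1 + b * q.2) {y : ℤ × ℤ}
    (hy : y ∈ AddSubmonoid.closure (↑Q : Set (ℤ × ℤ))) : 0 ≤ a * y.1 + b * y.2 := by
  induction hy using AddSubmonoid.closure_induction with
  | mem x hx => exact hq x (Finset.mem_coe.mp hx)
  | zero => simp
  | add x z _ _ ihx ihz =>
    simp only [Prod.fst_add, Prod.snd_add]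
    have h1 := mul_add a x.1 z.1
    have h2 := mul_add b x.2 z.2
    linarith

/-- If `y = w + c` with `w ∈ V` and `c` in the submonoid generated by `Q`, then no functional that is
nonnegative on `Q` separates `y` strictly below all of `V` (so `y` lies in `conv V + cone Q`). -/
theorem not_separated_of_eq_add {Q V : Finset (ℤ × ℤ)} {y w c : ℤ × ℤ} (hw : w ∈ V)
    (hc : c ∈ AddSubmonoid.closure (↑Q : Set (ℤ × ℤ))) (hy : y = w + c) :
    ¬ ∃ a b : ℤ, (∀ q ∈ Q, 0 ≤ a * q.1 + b * q.2) ∧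
        ∀ w' ∈ V, a * y.1 + b * y.2 < a * w'.1 + b * w'.2 := by
  rintro ⟨a, b, hq, hsep⟩
  have h1 := hsep w hw
  have h2 := linForm_nonneg_of_mem_closure hq hc
  subst hy
  simp only [Prod.fst_add, Prod.snd_add] at h1
  have h3 := mul_add a w.1 c.1
  have h4 := mul_add b w.2 c.2
  linarith

/-- **The core vertex bound is tight.**  For `Q = {(1,1),(4,3),(5,6)}`,
`V = {(8,6),(5,4),(3,3),(6,7),(10,12)}` and `D = {(0,0),(1,1),(2,2),(4,3),(5,6)}` all three
hypotheses of `CoreVertexBound` hold and `#(V ∖ Q) = #D = 5`: every vertex is a composite semigroup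
element with an explicit strict supporting functional, and every semigroup element other than the five
points of `D` lies in `V + S₀ ⊆ conv V + cone Q` (closure induction plus a finite check), hence is not
separated. -/
theorem coreVertexBound_tight :
    ∃ Q V D : Finset (ℤ × ℤ),
      (∀ v ∈ V, v ∈ AddSubmonoid.closure (↑Q : Set (ℤ × ℤ))) ∧
      (∀ v ∈ V, ∃ a b : ℤ, (∀ q ∈ Q, 0 < a * q.1 + b * q.2) ∧
          ∀ w ∈ V, w ≠ v → a * v.1 + b * v.2 < a * w.1 + b * w.2) ∧
      (∀ y ∈ AddSubmonoid.closure (↑Q : Set (ℤ × ℤ)),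
          (∃ a b : ℤ, (∀ q ∈ Q, 0 ≤ a * q.1 + b * q.2) ∧
            ∀ w ∈ V, a * y.1 + b * y.2 < a * w.1 + b * w.2) → y ∈ D) ∧
      (V \ Q).card = D.card := by
  refine ⟨{(1, 1), (4, 3), (5, 6)}, {(8, 6), (5, 4), (3, 3), (6, 7), (10, 12)},
    {(0, 0), (1, 1), (2, 2), (4, 3), (5, 6)}, ?_, ?_, ?_, by decide⟩
  · -- every vertex is a semigroup element
    have hg : ∀ q ∈ ({(1, 1), (4, 3), (5, 6)} : Finset (ℤ × ℤ)),
        q ∈ AddSubmonoid.closure (↑({(1, 1), (4, 3), (5, 6)} : Finset (ℤ × ℤ)) : Set (ℤ × ℤ)) :=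
      fun q hq => AddSubmonoid.subset_closure (Finset.mem_coe.mpr hq)
    have h11 := hg (1, 1) (by decide)
    have h43 := hg (4, 3) (by decide)
    have h56 := hg (5, 6) (by decide)
    intro v hv
    simp only [Finset.mem_insert, Finset.mem_singleton] at hv
    rcases hv with rfl | rfl | rfl | rfl | rfl
    · simpa using add_mem h43 h43
    · simpa using add_mem h11 h43
    · simpa using add_mem (add_mem h11 h11) h11
    · simpa using add_mem h11 h56
    · simpa using add_mem h56 h56
  · -- every vertex has a strict supporting functional, positive on the generators
    intro v hv
    simp only [Finset.mem_insert, Finset.mem_singleton] at hv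
    rcases hv with rfl | rfl | rfl | rfl | rfl
    · exact ⟨-30, 44, by decide, by decide⟩
    · exact ⟨-3, 5, by decide, by decide⟩
    · exact ⟨1, 1, by decide, by decide⟩
    · exact ⟨9, -7, by decide, by decide⟩
    · exact ⟨31, -25, by decide, by decide⟩
  · -- every semigroup point outside `D` is of the form `w + c`, `w ∈ V`, `c ∈ S₀`, hence not separated
    intro y hy
    have hg : ∀ q ∈ ({(1, 1), (4, 3), (5, 6)} : Finset (ℤ × ℤ)),
        q ∈ AddSubmonoid.closure (↑({(1, 1), (4, 3), (5, 6)} : Finset (ℤ × ℤ)) : Set (ℤ × ℤ)) :=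
      fun q hq => AddSubmonoid.subset_closure (Finset.mem_coe.mpr hq)
    have h11 := hg (1, 1) (by decide)
    -- the finite heart of the computation: sums of two outside points
    have key : ∀ x ∈ ({(0, 0), (1, 1), (2, 2), (4, 3), (5, 6)} : Finset (ℤ × ℤ)),
        ∀ z ∈ ({(0, 0), (1, 1), (2, 2), (4, 3), (5, 6)} : Finset (ℤ × ℤ)),
          x + z ∈ ({(0, 0), (1, 1), (2, 2), (4, 3), (5, 6)} : Finset (ℤ × ℤ)) ∨
          ∃ w ∈ ({(8, 6), (5, 4), (3, 3), (6, 7), (10, 12)} : Finset (ℤ × ℤ)),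
            ∃ c ∈ ({(0, 0), (1, 1), (6, 6)} : Finset (ℤ × ℤ)), x + z = w + c := by
      decide
    have hCs : ∀ c ∈ ({(0, 0), (1, 1), (6, 6)} : Finset (ℤ × ℤ)),
        c ∈ AddSubmonoid.closure (↑({(1, 1), (4, 3), (5, 6)} : Finset (ℤ × ℤ)) : Set (ℤ × ℤ)) := by
      intro c hc
      simp only [Finset.mem_insert, Finset.mem_singleton] at hc
      rcases hc with rfl | rfl | rfl
      · exact zero_mem _
      · exact h11
      · simpa using add_mem (add_mem (add_mem h11 h11) (add_mem h11 h11)) (add_mem h11 h11)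
    have P : y ∈ ({(0, 0), (1, 1), (2, 2), (4, 3), (5, 6)} : Finset (ℤ × ℤ)) ∨
        ∃ w ∈ ({(8, 6), (5, 4), (3, 3), (6, 7), (10, 12)} : Finset (ℤ × ℤ)),
          ∃ c ∈ AddSubmonoid.closure (↑({(1, 1), (4, 3), (5, 6)} : Finset (ℤ × ℤ)) : Set (ℤ × ℤ)),
            y = w + c := by
      induction hy using AddSubmonoid.closure_induction with
      | mem x hx =>
        left
        have hx' := Finset.mem_coe.mp hx
        simp only [Finset.mem_insert, Finset.mem_singleton] at hx'
        rcases hx' with rfl | rfl | rfl <;> decide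
      | zero => left; decide
      | add x z hx hz ihx ihz =>
        rcases ihx with hxD | ⟨w, hw, c, hc, rfl⟩
        · rcases ihz with hzD | ⟨w, hw, c, hc, rfl⟩
          · rcases key x hxD z hzD with h | ⟨w, hw, c, hc, h⟩
            · exact Or.inl h
            · exact Or.inr ⟨w, hw, c, hCs c hc, h⟩
          · exact Or.inr ⟨w, hw, x + c, add_mem hx hc, by rw [add_left_comm]⟩
        · exact Or.inr ⟨w, hw, c + z, add_mem hc hz, by rw [add_assoc]⟩
    intro hsep
    rcases P with hD | ⟨w, hw, c, hc, hyc⟩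
    · exact hD
    · exact absurd hsep (not_separated_of_eq_add hw hc hyc)

/-- The "clean form" of the core theorem as a consequence of `CoreVertexBound`: if in addition no
generator lies in `H` (each `q ∈ Q` is separated from `V` by a functional nonnegative on `Q`), then no
vertex is a generator and the full vertex count is bounded by `#D`, i.e. `#V ≤ #(S₀ ∖ H)`. -/
theorem card_le_of_coreVertexBound (h : CoreVertexBound) (Q V D : Finset (ℤ × ℤ))
    (hS : ∀ v ∈ V, v ∈ AddSubmonoid.closure (↑Q : Set (ℤ × ℤ)))
    (hV : ∀ v ∈ V, ∃ a b : ℤ, (∀ q ∈ Q, 0 < a * q.1 + b * q.2) ∧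
        ∀ w ∈ V, w ≠ v → a * v.1 + b * v.2 < a * w.1 + b * w.2)
    (hD : ∀ y ∈ AddSubmonoid.closure (↑Q : Set (ℤ × ℤ)),
        (∃ a b : ℤ, (∀ q ∈ Q, 0 ≤ a * q.1 + b * q.2) ∧
          ∀ w ∈ V, a * y.1 + b * y.2 < a * w.1 + b * w.2) → y ∈ D)
    (hQ : ∀ q ∈ Q, ∃ a b : ℤ, (∀ q' ∈ Q, 0 ≤ a * q'.1 + b * q'.2) ∧
        ∀ w ∈ V, a * q.1 + b * q.2 < a * w.1 + b * w.2) :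
    V.card ≤ D.card := by
  have hdisj : Disjoint V Q := by
    refine Finset.disjoint_left.mpr ?_
    intro v hvV hvQ
    obtain ⟨a, b, -, hsep⟩ := hQ v hvQ
    exact lt_irrefl _ (hsep v hvV)
  have hVQ : V \ Q = V := Finset.sdiff_eq_self_iff_disjoint.mpr hdisj
  simpa [hVQ] using h Q V D hS hV hD

end Summit.ValiantsHypothesis.ValiantsHypothesis.Theorems
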